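import Literature.AlgebraicGeometry.HodgeTheory.FermatHodgeConjectureProofs
import Literature.AlgebraicGeometry.HodgeTheory.HodgeConjectureQbarVoisinProofs
import Literature.AlgebraicGeometry.HodgeTheory.ComplexConjugation
import Literature.AlgebraicGeometry.HodgeTheory.DiagonalSymmetry
import Literature.AlgebraicGeometry.HodgeTheory.IsoTransport
import Literature.AlgebraicGeometry.Motives.FermatHypersurface
import Literature.AlgebraicGeometry.Motives.SmoothHypersurfaceExistenceProofs
import Literature.AlgebraicGeometry.Motives.HypersurfaceFieldPoints
import Literature.NumberTheory.Transcendental.AnalytificationFunctorialityProofs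
import HarnessLib

/-!
# The Fermat variety up to isomorphism: reduction of the middle degree to the standard model `V₊(Σ xᵢᵐ)`

Family `hodge`, layer `Literature/AlgebraicGeometry/HodgeTheory`. Brick of the middle-degree case of
the named fact `hodgeClasses_algebraic_fermat` (file `FermatHodgeConjecture`; Shioda, Proc. Japan
Acad. 55A (1979) Thm. 1; Ran, Compositio Math. 42 (1980) Thm. 4.9). The fact quantifies over ALL
`ℂ`-schemes `X` with `Motives.IsFermatVariety n m X` (reduced, with a closed immersion into `ℙⁿ⁺¹_ℂ`
of image `V₊(x₀ᵐ + ⋯ + x_{n+1}ᵐ)`) and `Motives.IsSmoothProjective n X`, whereas the symmetry group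
`μₘⁿ⁺²`, its eigenspaces and projectors (files `DiagonalSymmetry`, `DiagonalCharacterEigenspace`,
`FermatDiagonalAction`) live on the STANDARD MODEL
`fermatHypersurface n m = Motives.SmoothHypersurface.hypersurface (fermatPolynomial ℂ n m)` (the reduced
induced structure on `V₊(Σ xᵢᵐ)`). This file PROVES that the middle-degree statement for the standard
model implies it for every such `X` (`hodgeClasses_algebraic_fermat_middle_of_fermatHypersurface`),
through:

* `Motives.isoOfClosedImmersionsOfRangeEq` — two closed immersions of REDUCED schemes into the same
  scheme with the same image are isomorphic over it (universal property of the reduced induced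
  structure, Hartshorne II Ex. 3.11 (d); the tree's `Motives.liftOfRangeSubset` both ways);
  `Motives.IsFermatVariety.isoFermatHypersurface : X ≅ fermatHypersurface n m` over `ℂ`;
* `isSmoothHypersurface_fermatHypersurface`, `isSmoothProjective_fermatHypersurface`,
  `isFermatVariety_fermatHypersurface` — the standard model is a smooth hypersurface for `n, m ≥ 1`
  (Jacobian criterion and Eisenstein, the tree's `isSmoothHypersurface_hypersurface`,
  `isNonsingularForm_sum_X_pow`, `irreducible_sum_X_pow`; Hartshorne I Ex. 5.5, II 8.20.2) — now
  one-line aliases of the general-field statements of `Motives/FermatHypersurface`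
  (`SmoothHypersurface.isSmoothHypersurface_hypersurface_fermatPolynomial_of_charZero`, …), which
  hold the proofs;
* transport of the three predicates of the fact along an isomorphism `e : X' ≅ X` of `ℂ`-schemes:
  `Motives.AlgPoints.homeomorphOfIso` (`e(ℂ)` is a homeomorphism), `IsRationalClass.map` (tree),
  `mem_algebraicClasses_map_of_iso` (isomorphisms are flat: the tree's
  `map_mem_algebraicClasses_of_flat`), and **`IsOfHodgeType.map_of_iso`**: a Hodge model `A` of `X`
  (analytification `φ : A.carrier → X(ℂ)` + comparison + Hodge decomposition) yields the Hodge model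
  `A.ofIso e` of `X'` with the SAME complex manifold and comparison and analytification
  `e⁻¹(ℂ) ∘ φ` (`IsAnalytification.comp_map_iso`: regular functions on `X'` pull back along `e` to
  regular functions on `X`, `AlgPoints.evalOrZero_map`), in which `e^* c` has the same pull-back as
  `c` has in `A`. No rigidity of Hodge models is needed.

## Relation to `HodgeTheory/IsoTransport`

`IsoTransport` (light import cone: `RationalHodgeClasses`, `GysinFormalism`,
`AnalytificationFunctorialityProofs`) proves the hypothesis-free `iff` forms of the transport
statements (`isRationalClass_map_iff_of_iso`, `isOfHodgeType_map_iff_of_iso`,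
`mem_algebraicClasses_map_iff_of_iso`) and holds the surviving proofs of the two statements this
file shares with it byte for byte: `IsAnalytification.comp_map_iso` is an alias of
`IsAnalytification.transport_iso` and `map_hom_map_inv_apply` of
`CategoryTheory.Iso.complexBetti_map_hom_map_inv`, while `IsOfHodgeType.map_of_iso` and
`mem_algebraicClasses_map_of_iso` are the backward implications of its `iff`s (work item
`defn-IsoTransportHeavyAliases`); the names and signatures of this file are kept because
problem-side files use them.

## References

* [Shioda1979PJA] T. Shioda, The Hodge conjecture and the Tate conjecture for Fermat varieties,
  Proc. Japan Acad. 55A (1979) 111–114, §1 (`Xⁿₘ` "defined by the equation (1)"), §2 Thm. 1.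
* [Hartshorne1977] R. Hartshorne, Algebraic Geometry (1977), II Ex. 3.11 (d) (reduced induced
  structure: uniqueness), I Ex. 5.5, II Example 8.20.2, III Prop. 9.5.
* [SerreGAGA1956] J.-P. Serre, GAGA, Ann. Inst. Fourier 6 (1956), §2 (analytification is functorial).
-/

noncomputable section

open CategoryTheory AlgebraicGeometry
open scoped Manifold ContDiff

universe u

/-! ### Closed immersions of reduced schemes with the same image are isomorphic -/

namespace Literature.AlgebraicGeometry.Motives

section Iso

variable {T T' P : Scheme.{u}} (ι : T ⟶ P) (ι' : T' ⟶ P)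

/-- **Uniqueness of the reduced induced structure**: two closed immersions `ι : T → P`,
`ι' : T' → P` of REDUCED schemes with `range ι = range ι'` are isomorphic over `P` — each factors
uniquely through the other (`liftOfRangeSubset`). Hartshorne II Ex. 3.11 (d).
[cite: Hartshorne1977, II Ex. 3.11 (d)] -/
def isoOfClosedImmersionsOfRangeEq [IsClosedImmersion ι] [IsClosedImmersion ι'] [IsReduced T] [IsReduced T']
    (h : Set.range ι = Set.range ι') : T ≅ T' where
  hom := liftOfRangeSubset ι' ι h.le
  inv := liftOfRangeSubset ι ι' h.ge
  hom_inv_id := by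
    rw [← cancel_mono ι, Category.assoc, liftOfRangeSubset_comp, liftOfRangeSubset_comp, Category.id_comp]
  inv_hom_id := by
    rw [← cancel_mono ι', Category.assoc, liftOfRangeSubset_comp, liftOfRangeSubset_comp, Category.id_comp]

/-- The isomorphism commutes with the immersions. [cite: Hartshorne1977, II Ex. 3.11 (d)] -/
@[reassoc (attr := simp)]
theorem isoOfClosedImmersionsOfRangeEq_hom_comp [IsClosedImmersion ι] [IsClosedImmersion ι'] [IsReduced T]
    [IsReduced T'] (h : Set.range ι = Set.range ι') :
    (isoOfClosedImmersionsOfRangeEq ι ι' h).hom ≫ ι' = ι :=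
  liftOfRangeSubset_comp ι' ι h.le

variable {k : Type u} [Field k] {X X' Q : SchemeOver k} (j : X ⟶ Q) (j' : X' ⟶ Q)

/-- `k`-scheme form: two closed `k`-immersions of reduced `k`-schemes into `Q` with the same image
are isomorphic over `k`. [cite: Hartshorne1977, II Ex. 3.11 (d)] -/
def isoOverOfClosedImmersionsOfRangeEq [IsClosedImmersion j.left] [IsClosedImmersion j'.left]
    [IsReduced X.left] [IsReduced X'.left] (h : Set.range j.left = Set.range j'.left) : X ≅ X' :=
  Over.isoMk (isoOfClosedImmersionsOfRangeEq j.left j'.left h) (by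
    change liftOfRangeSubset j'.left j.left h.le ≫ X'.hom = X.hom
    rw [← Over.w j', liftOfRangeSubset_comp_assoc, Over.w j])

/-- The `k`-isomorphism commutes with the immersions. [cite: Hartshorne1977, II Ex. 3.11 (d)] -/
@[reassoc (attr := simp)]
theorem isoOverOfClosedImmersionsOfRangeEq_hom_comp [IsClosedImmersion j.left] [IsClosedImmersion j'.left]
    [IsReduced X.left] [IsReduced X'.left] (h : Set.range j.left = Set.range j'.left) :
    (isoOverOfClosedImmersionsOfRangeEq j j' h).hom ≫ j' = j := by
  ext : 1
  rw [Over.comp_left]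
  exact liftOfRangeSubset_comp j'.left j.left h.le

end Iso

/-! ### `e(ℂ)` for an isomorphism `e` is a homeomorphism -/

namespace AlgPoints

variable {k : Type u} [Field k] {X Y : SchemeOver k} {L : Type u} [Field L] [Algebra k L] [TopologicalSpace L]

/-- **An isomorphism of `k`-schemes induces a homeomorphism `X(L) ≃ₜ Y(L)`** of `L`-points with their
strong topologies (`map e.hom`, inverse `map e.inv`; the two inverse laws are `map_inv_map_hom_apply`,
`map_hom_map_inv_apply` of `HodgeTheory/IsoTransport`, whose `isHomeomorph_map_of_iso` is the
unbundled form). [folklore] -/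
def homeomorphOfIso (e : X ≅ Y) : AlgPoints X L ≃ₜ AlgPoints Y L where
  toFun := map e.hom
  invFun := map e.inv
  left_inv := map_inv_map_hom_apply e
  right_inv := map_hom_map_inv_apply e
  continuous_toFun := continuous_map e.hom
  continuous_invFun := continuous_map e.inv

/-- `homeomorphOfIso e` is `map e.hom`. [folklore] -/
@[simp]
theorem coe_homeomorphOfIso (e : X ≅ Y) : (homeomorphOfIso (L := L) e : AlgPoints X L → AlgPoints Y L) = map e.hom := rfl

end AlgPoints

end Literature.AlgebraicGeometry.Motives

/-! ### Analytifications and Hodge models transport along isomorphisms -/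

namespace Literature.NumberTheory.Transcendental

open Literature.AlgebraicGeometry.Motives

/-- **Analytifications transport along isomorphisms of `ℂ`-schemes**: if `φ : M → X(ℂ)` is an
analytification of `X` and `e : X ≅ X'`, then `e(ℂ) ∘ φ` is an analytification of `X'` — `e(ℂ)` is a
homeomorphism, and a regular function `s` on an affine open `U ⊆ X'` pulls back along `e(ℂ) ∘ φ` to
the pull-back along `φ` of the regular function `e^* s` on the affine open `e⁻¹U ⊆ X`
(`AlgPoints.evalOrZero_map`). Serre, GAGA §2 (functoriality of `X ↦ X^h`). ALIAS (same statement) of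
`IsAnalytification.transport_iso` of `HodgeTheory/IsoTransport`, which holds the proof (light import
cone); kept under this name for its users — prefer `transport_iso` in new files.
[cite: SerreGAGA1956, §2] -/
theorem IsAnalytification.comp_map_iso {E : Type*} [NormedAddCommGroup E] [NormedSpace ℂ E]
    [FiniteDimensional ℂ E] {M : Type*} [TopologicalSpace M] [ChartedSpace E M]
    {X X' : SchemeOver ℂ} {d : ℕ} {φ : M → ComplexPoints X}
    (hφ : IsAnalytification E X d φ) (e : X ≅ X') :
    IsAnalytification E X' d (AlgPoints.map e.hom ∘ φ) :=
  hφ.transport_iso e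

end Literature.NumberTheory.Transcendental

namespace Literature.AlgebraicGeometry.HodgeTheory

open Literature.AlgebraicGeometry.Motives Literature.AlgebraicTopology.SingularHomology
  Literature.NumberTheory.Transcendental

section Transport

variable {n : ℕ} {X X' : Motives.SchemeOver ℂ}

/-- **Hodge models transport along isomorphisms**: the Hodge model of `X'` with the same complex
manifold, comparison family and Hodge decomposition as the Hodge model `A` of `X`, and
analytification `e⁻¹(ℂ) ∘ A.toComplexPoints : A.carrier → X'(ℂ)` for `e : X' ≅ X`.
[cite: SerreGAGA1956, §2] -/
def HodgeModel.ofIso (A : HodgeModel n X) (e : X' ≅ X) : HodgeModel n X' :=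
  { A with
    toComplexPoints := AlgPoints.map e.inv ∘ A.toComplexPoints
    isAnalytification := A.isAnalytification.comp_map_iso e.symm }

/-- The `H^{p,q}` of the transported model are those of `A` (same manifold, same comparison).
[cite: SerreGAGA1956, §2] -/
theorem HodgeModel.hodgePQ_ofIso (A : HodgeModel n X) (e : X' ≅ X) (k p q : ℕ) :
    (A.ofIso e).hodgePQ k p q = A.hodgePQ k p q := rfl

/-- **Pull-back in the transported model**: `(A.ofIso e).pullback (e^* c) = A.pullback c`
(`e⁻¹(ℂ)` followed by `e(ℂ)` is the identity). [cite: SerreGAGA1956, §2] -/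
theorem HodgeModel.pullback_ofIso_map (A : HodgeModel n X) (e : X' ≅ X) (k : ℕ)
    (c : singularCohomology ℂ ℂ (Motives.ComplexPoints X) k) :
    (A.ofIso e).pullback k (singularCohomology.map ℂ ℂ (Motives.AlgPoints.mapContinuous (L := ℂ) e.hom) k c) =
      A.pullback k c := by
  have hc : (Motives.AlgPoints.mapContinuous (L := ℂ) e.hom).comp
        (⟨(A.ofIso e).toComplexPoints, (A.ofIso e).isAnalytification.isHomeomorph.continuous⟩ :
          C(A.carrier, Motives.ComplexPoints X')) =
      ⟨A.toComplexPoints, A.isAnalytification.isHomeomorph.continuous⟩ := by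
    refine ContinuousMap.ext fun x ↦ ?_
    change Motives.AlgPoints.map e.hom (Motives.AlgPoints.map e.inv (A.toComplexPoints x)) = A.toComplexPoints x
    rw [← Motives.AlgPoints.map_comp_apply, Iso.inv_hom_id, Motives.AlgPoints.map_id_apply]
  have h2 := congrArg (fun f ↦ singularCohomology.map ℂ ℂ f k c) hc
  simp only at h2
  rw [singularCohomology.map_comp] at h2
  exact h2

/-- **Hodge types transport along isomorphisms**: if `c ∈ Hᵏ(X(ℂ); ℂ)` is of Hodge type `(p, q)`
(for some Hodge model `A` of `X`) and `e : X' ≅ X`, then `e^* c ∈ Hᵏ(X'(ℂ); ℂ)` is of Hodge type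
`(p, q)`, witnessed by the transported model `A.ofIso e` (`HodgeModel.pullback_ofIso_map`,
`HodgeModel.hodgePQ_ofIso`). Proved as the backward implication of the hypothesis-free
`isOfHodgeType_map_iff_of_iso` of `HodgeTheory/IsoTransport` (same witness), which holds the proof;
kept under this name for its users. [cite: SerreGAGA1956, §2] [cite: VoisinHodgeI2002, §7.3.2] -/
theorem IsOfHodgeType.map_of_iso (e : X' ≅ X) {k p q : ℕ}
    {c : singularCohomology ℂ ℂ (Motives.ComplexPoints X) k} (hc : IsOfHodgeType n X k p q c) :
    IsOfHodgeType n X' k p q (singularCohomology.map ℂ ℂ (Motives.AlgPoints.mapContinuous (L := ℂ) e.hom) k c) :=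
  (isOfHodgeType_map_iff_of_iso e).2 hc

/-- **Algebraic classes transport along isomorphisms** of smooth projective `ℂ`-schemes:
`e^* c ∈ algebraicClasses X' p` for `c ∈ algebraicClasses X p`, `e : X' ≅ X`. The former proof
went through flat pull-back (isomorphisms are flat; the tree's `map_mem_algebraicClasses_of_flat`,
which needs locally Noetherian schemes, whence `hX`, `hX'`; Hartshorne III Prop. 9.5); it is now
the backward implication of the hypothesis-free `mem_algebraicClasses_map_iff_of_iso` of
`HodgeTheory/IsoTransport` (an isomorphism preserves closed subsets and codimension; Grothendieck,
Topology 8 (1969) §1), which holds the proof. The smooth-projectivity hypotheses are therefore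
superfluous but stay in the signature, which the users of this lemma apply.
[cite: GrothendieckTopology1969, §1] [cite: Hartshorne1977, III Prop. 9.5] -/
theorem mem_algebraicClasses_map_of_iso {n' : ℕ} (hX : IsSmoothProjective n X) (hX' : IsSmoothProjective n' X')
    (e : X' ≅ X) {p : ℕ} {c : complexBetti X (2 * p)} (hc : c ∈ algebraicClasses X p) :
    complexBetti.map e.hom (2 * p) c ∈ algebraicClasses X' p := by
  have _ := hX; have _ := hX' -- superfluous along an isomorphism; kept in the signature (see above)
  exact (mem_algebraicClasses_map_iff_of_iso e).2 hc

/-- `e^* (e⁻¹)^* c = c` on `Hᵏ(X(ℂ); ℂ)` (stated through `singularCohomology.map` of `e(ℂ)`,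
`e⁻¹(ℂ)`, i.e. `complexBetti.map e.hom k (complexBetti.map e.inv k c) = c` unfolded). ALIAS (same
statement up to unfolding the `abbrev complexBetti.map`) of the `simp` lemma
`CategoryTheory.Iso.complexBetti_map_hom_map_inv` of `HodgeTheory/IsoTransport`, which holds the
proof; kept under this name for its users — prefer `e.complexBetti_map_hom_map_inv` in new files.
[folklore] -/
theorem map_hom_map_inv_apply (e : X' ≅ X) (k : ℕ) (c : complexBetti X' k) :
    singularCohomology.map ℂ ℂ (Motives.AlgPoints.mapContinuous (L := ℂ) e.hom) k
      (singularCohomology.map ℂ ℂ (Motives.AlgPoints.mapContinuous (L := ℂ) e.inv) k c) = c :=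
  e.complexBetti_map_hom_map_inv k c

end Transport

/-! ### The standard model `V₊(Σ xᵢᵐ)` of the Fermat variety -/

section Standard

/-- **The standard model of the Fermat variety `Xⁿₘ`**: the hypersurface `V₊(x₀ᵐ + ⋯ + x_{n+1}ᵐ)`
in `ℙⁿ⁺¹_ℂ` with its reduced induced structure (`Motives.SmoothHypersurface.hypersurface` of the Fermat
form). [cite: Shioda1979PJA, §1 eq. (1)] -/
abbrev fermatHypersurface (n m : ℕ) : Motives.SchemeOver ℂ :=
  SmoothHypersurface.hypersurface (fermatPolynomial ℂ n m)

variable {n m : ℕ}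

/-- **The standard model is a smooth hypersurface of dimension `n` and degree `m`** for `n ≥ 1`,
`m ≥ 1` (Jacobian criterion: `∂ᵢ = m xᵢ^{m-1}`; irreducibility by Eisenstein at `(ζ, 1, 0, …, 0)`,
`ζᵐ = -1`, over every overfield of `ℂ`). ALIAS (by `rfl` on `fermatHypersurface`) of the `ℂ`-case of
`SmoothHypersurface.isSmoothHypersurface_hypersurface_fermatPolynomial_of_charZero`
(`Motives/FermatHypersurface`, which holds the proof over a general field); kept under this name
for its users. [cite: Hartshorne1977, I Ex. 5.5 and II Example 8.20.2] -/
theorem isSmoothHypersurface_fermatHypersurface (hn : 1 ≤ n) (hm : 1 ≤ m) :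
    IsSmoothHypersurface n m (fermatHypersurface n m) :=
  SmoothHypersurface.isSmoothHypersurface_hypersurface_fermatPolynomial_of_charZero hn hm

/-- The standard model is smooth projective of dimension `n` (`n, m ≥ 1`); alias of the `ℂ`-case of
`SmoothHypersurface.isSmoothProjective_hypersurface_fermatPolynomial_of_charZero`
(`Motives/FermatHypersurface`). [cite: Hartshorne1977, I Ex. 5.5 and II Example 8.20.2] -/
theorem isSmoothProjective_fermatHypersurface (hn : 1 ≤ n) (hm : 1 ≤ m) :
    IsSmoothProjective n (fermatHypersurface n m) :=
  SmoothHypersurface.isSmoothProjective_hypersurface_fermatPolynomial_of_charZero hn hm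

/-- The standard model IS a Fermat variety in the sense of `Motives.IsFermatVariety`; alias of the
`ℂ`-case of `SmoothHypersurface.isFermatVariety_hypersurface_fermatPolynomial`
(`Motives/FermatHypersurface`), which holds for ALL `m` (the reduced induced structure is reduced for
every form) — the hypothesis `1 ≤ m` of this older statement is superfluous and stays in the
signature only for its users. [cite: Shioda1979PJA, §1 eq. (1)] -/
theorem isFermatVariety_fermatHypersurface (hm : 1 ≤ m) : IsFermatVariety n m (fermatHypersurface n m) := by
  have _ := hm -- superfluous; kept in the signature (see above)
  exact SmoothHypersurface.isFermatVariety_hypersurface_fermatPolynomial ℂ n m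

/-- **Every Fermat variety is isomorphic over `ℂ` to the standard model**: `X` reduced with a closed
immersion onto `V₊(Σ xᵢᵐ)`, and the standard model likewise (uniqueness of the reduced induced
structure). [cite: Hartshorne1977, II Ex. 3.11 (d)] [cite: Shioda1979PJA, §1 eq. (1)] -/
def _root_.Literature.AlgebraicGeometry.Motives.IsFermatVariety.isoFermatHypersurface {X : Motives.SchemeOver ℂ}
    (hF : IsFermatVariety n m X) : X ≅ fermatHypersurface n m :=
  letI := MvPolynomial.gradedAlgebra (σ := Fin (n + 2)) (R := ℂ)
  haveI : IsReduced X.left := hF.1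
  haveI : IsClosedImmersion hF.2.choose.left := hF.2.choose_spec.1
  isoOverOfClosedImmersionsOfRangeEq hF.2.choose (SmoothHypersurface.hypersurfaceι (fermatPolynomial ℂ n m))
    (hF.2.choose_spec.2.trans (SmoothHypersurface.range_hypersurfaceι _).symm)

end Standard

/-! ### The middle degree reduces to the standard model -/

section Reduction

/-- **Reduction of the middle-degree case of `hodgeClasses_algebraic_fermat` to the standard model.**
If for all `p > 0` and `m` prime or `1 < m ≤ 20` every rational class of Hodge type `(p, p)` in
`H²ᵖ` of the STANDARD MODEL `V₊(Σᵢ xᵢᵐ) ⊂ ℙ²ᵖ⁺¹_ℂ` is algebraic, then the same holds for every smooth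
projective `ℂ`-scheme `X` with `IsFermatVariety (2p) m X` — the exact hypothesis `hmid` of
`hodgeClasses_algebraic_fermat_of_middle`. Transport along `e : X ≅ V₊(Σ xᵢᵐ)`: `(e⁻¹)^* c` is
rational, of type `(p, p)` (`IsOfHodgeType.map_of_iso`) and hence algebraic on the standard model,
and `c = e^* (e⁻¹)^* c` is algebraic on `X` (`mem_algebraicClasses_map_of_iso`).
[cite: Shioda1979PJA, §2 Thm. 1 and the list after it (p. 112)] [cite: Hartshorne1977, II Ex. 3.11 (d)] -/
theorem hodgeClasses_algebraic_fermat_middle_of_fermatHypersurface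
    (h : ∀ ⦃p m : ℕ⦄, m.Prime ∨ (1 < m ∧ m ≤ 20) → 0 < p →
      ∀ c : complexBetti (fermatHypersurface (2 * p) m) (2 * p), IsRationalClass c →
        IsOfHodgeType (2 * p) (fermatHypersurface (2 * p) m) (2 * p) p p c →
          c ∈ algebraicClasses (fermatHypersurface (2 * p) m) p) :
    ∀ ⦃p m : ℕ⦄ ⦃X : Motives.SchemeOver ℂ⦄, m.Prime ∨ (1 < m ∧ m ≤ 20) →
      Motives.IsFermatVariety (2 * p) m X → Motives.IsSmoothProjective (2 * p) X → 0 < p →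
        ∀ c : complexBetti X (2 * p), IsRationalClass c →
          IsOfHodgeType (2 * p) X (2 * p) p p c → c ∈ algebraicClasses X p := by
  intro p m X hm hF hX hp c hc hpp
  have hm1 : 1 ≤ m := one_le_of_prime_or hm
  have hX' : IsSmoothProjective (2 * p) (fermatHypersurface (2 * p) m) :=
    isSmoothProjective_fermatHypersurface (by omega) hm1
  let e : X ≅ fermatHypersurface (2 * p) m := hF.isoFermatHypersurface
  -- the class transported to the standard model
  set c' : complexBetti (fermatHypersurface (2 * p) m) (2 * p) :=
    singularCohomology.map ℂ ℂ (Motives.AlgPoints.mapContinuous (L := ℂ) e.inv) (2 * p) c with hc'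
  have hc'rat : IsRationalClass c' := hc.map _
  have hc'pp : IsOfHodgeType (2 * p) (fermatHypersurface (2 * p) m) (2 * p) p p c' :=
    hpp.map_of_iso e.symm
  have hc'alg := h hm hp c' hc'rat hc'pp
  have := mem_algebraicClasses_map_of_iso hX' hX e hc'alg
  rwa [hc', show complexBetti.map e.hom (2 * p)
      (singularCohomology.map ℂ ℂ (Motives.AlgPoints.mapContinuous (L := ℂ) e.inv) (2 * p) c) = c from
    map_hom_map_inv_apply e (2 * p) c] at this

/-- **The named fact from Lefschetz and the middle degree ON THE STANDARD MODEL** (assembly of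
`hodgeClasses_algebraic_fermat_of_middle` with the reduction): granted
`Voisin2003_smoothHypersurface_algebraicClasses_eq_top`, it suffices to treat rational `(p, p)`-classes
in `H²ᵖ(V₊(Σᵢ₌₀^{2p+1} xᵢᵐ)(ℂ); ℂ)`, `p > 0`, `m` prime or `1 < m ≤ 20`.
[cite: Shioda1979PJA, §2 Thm. 1 and the list after it (p. 112)] -/
theorem hodgeClasses_algebraic_fermat_of_fermatHypersurface
    (hL : Voisin2003_smoothHypersurface_algebraicClasses_eq_top)
    (h : ∀ ⦃p m : ℕ⦄, m.Prime ∨ (1 < m ∧ m ≤ 20) → 0 < p →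
      ∀ c : complexBetti (fermatHypersurface (2 * p) m) (2 * p), IsRationalClass c →
        IsOfHodgeType (2 * p) (fermatHypersurface (2 * p) m) (2 * p) p p c →
          c ∈ algebraicClasses (fermatHypersurface (2 * p) m) p) :
    hodgeClasses_algebraic_fermat :=
  hodgeClasses_algebraic_fermat_of_middle hL (hodgeClasses_algebraic_fermat_middle_of_fermatHypersurface h)

end Reduction

end Literature.AlgebraicGeometry.HodgeTheory

end
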